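import Summits.HodgeConjecture.HodgeConjecture.Theorems.Ring2WeilCoverageCMFieldBiquadraticIntegerClasses
import Summits.HodgeConjecture.HodgeConjecture.Theorems.Ring2WeilCoverageCMFieldRationalPrimeRuleInstancesIII
import Summits.HodgeConjecture.HodgeConjecture.Theorems.Ring2WeilCoverageCMFieldRationalPrimeRuleInstancesIV
import HarnessLib

/-!
# Ring 2 — Weil-family coverage, CM-field rows: THE INTEGER ROWS `W8.E.[n]` of the biquadratic b03.29 tables, III — the `ℚ(ζ₆₀)`-fields
  (WEIL-FAMILY-COVERAGE «## b03», cell (xxi⁵), part 31)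

research route conditional on HC_CM; not a corollary; Q11.4-sentence-2 already refuted in dim ≥ 3.

On Deligne's carrier `R = S² + pS + q` (`F = ℚ(θ)`, `E = F(√θ)`, classes `[n] ∈ F^×/Nm_{E/F}(E^×)` labelled by their `T`-sets)
[cite: Deligne1982HodgeCycles, §4 p. 30, (1), Cor. 4.2] the biquadratic b03.29 fields `E = F(√b₀)` have their PRIMES
classified by parts 16–19 (`[ℓ] ≠ [1] ⟺ ℓ` in explicit classes mod `24 ∕ 40 ∕ 60`; every prime dividing `2·disc·b₀` is a
norm).  Part IX-M's `natCast_eq_split_iff_even` turns this into the classification of ALL integer rows once each non-split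
prime obstructs with a cofactor (`[ℓ·w] ≠ [1]`, `ℓ ∤ w`) — supplied by the cofactor transfer of part 29 (§72).  This file: §81–§83 the
three `ℚ(ζ₆₀)`-fields `ℚ(i,√15)`, `ℚ(√-5,√3)`, `ℚ(√-3,√-5)`: **`[n] = [1] ⟺` every non-split prime divides `n` to an even
power; `[n₁] = [n₂] ⟺` equal parities** — completing, with parts IX-M∕N (six Galois census fields), 28 (three cyclic
b03.29 fields), 29 and 30, the integer rows of ALL TWENTY Galois quartic CM-field tables of the census.
No new definition, no named fact, no sorry; nothing about the Hodge conjecture is asserted (index-set bookkeeping only).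
-/

noncomputable section

set_option linter.dupNamespace false

open Polynomial NumberField IsDedekindDomain

namespace Summit.HodgeConjecture.HodgeConjecture.Ring2.WeilCoverageCM

open Literature.AlgebraicGeometry.Deligne1982
open Literature.AlgebraicGeometry.HodgeTheory (splitDiscriminantClassCM)
open Literature.NumberTheory.QuadraticForms

variable {R : Polynomial ℤ} [Fact (Irreducible (cmPolyQ R))] [Fact (Irreducible (realPolyQ R))]

/-! ### §81 `E = ℚ(i,√15)` (`R = S² + 32S + 196`, `F = ℚ(√15)`): non-split primes `ℓ % 60 = 7 ∨ ℓ % 60 = 11 ∨ ℓ % 60 = 43 ∨ ℓ % 60 = 59` -/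
section IsqrtNeg1Sqrt15
/-- **Cofactor obstruction for `ℚ(i,√15)`**: for every non-split prime `ℓ` (`ℓ % 60 = 7 ∨ ℓ % 60 = 11 ∨ ℓ % 60 = 43 ∨ ℓ % 60 = 59`) and every `w ∈ ℤ` with
`ℓ ∤ w`: `[ℓ·w] ≠ [(-1)^k]` (`k` even) — the inert degree-one place over `ℓ` of part 12 has `ord_v(ℓw) = ord_v ℓ` odd.
[cite: Deligne1982HodgeCycles, §4 (1) and Cor. 4.2] [cite: Omeara1963, §63B Example 63:12 and §71D Thm. 71:18] -/
theorem sqrtNeg1Sqrt15_mk_natCast_mul_ne_splitDiscriminantClassCM (hR : R = X ^ 2 + C 32 * X + C 196) {ℓ : ℕ} (hℓ : ℓ.Prime)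
    (hS : ℓ % 60 = 7 ∨ ℓ % 60 = 11 ∨ ℓ % 60 = 43 ∨ ℓ % 60 = 59) {w : ℤ} (hw : ¬ (ℓ : ℤ) ∣ w) (qℓ : (realField R)ˣ)
    (hqℓ : (qℓ : realField R) = (ℓ : realField R) * (w : realField R)) {k : ℕ} (hk : Even k) :
    (QuotientGroup.mk qℓ : cmNormResidueGroup R) ≠ splitDiscriminantClassCM R k := by
  haveI := Fact.mk hℓ
  have hroots := roots_real_neg_of_quadratic hR (by norm_num) (by norm_num) (by norm_num)
  have hrel := root_rel_quadratic hR
  push_cast at hrel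
  have hℓ0 : (ℓ : realField R) ≠ 0 := by exact_mod_cast hℓ.ne_zero
  have hne := (sqrtNeg1Sqrt15_mk_prime_ne_splitDiscriminantClassCM_iff_mod hR hℓ (Units.mk0 _ hℓ0) (Units.val_mk0 _)
    even_two).2 hS
  have hfac : AdjoinRoot.root (realPolyQ R) = -((-7 : realField R) + (-1/2 : realField R) * AdjoinRoot.root (realPolyQ R)) ^ 2 := by
    linear_combination (1/4 : realField R) * hrel
  exact mk_natCast_mul_ne_splitDiscriminantClassCM_of_ne_of_root_eq_neg_sq hroots hfac (sqrtNeg1Sqrt15_ratPrimeRule_dyadic_unique hR)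
    hℓ (Units.mk0 _ hℓ0) (Units.val_mk0 _) even_two hne hw qℓ hqℓ hk

/-- **THE INTEGER ROWS of the `ℚ(i,√15)` table**: for `n ≥ 1`, **`[n] = [1] ⟺` every prime `ℓ` with `ℓ % 60 = 7 ∨ ℓ % 60 = 11 ∨ ℓ % 60 = 43 ∨ ℓ % 60 = 59` divides `n`
to an EVEN power** (part IX-M's induction; no exceptional prime). [cite: Deligne1982HodgeCycles, §4 (1) and Cor. 4.2]
[cite: Landherr1936HermitianForms] -/
theorem sqrtNeg1Sqrt15_natCast_eq_splitDiscriminantClassCM_iff (hR : R = X ^ 2 + C 32 * X + C 196) (n : ℕ) (hn : 1 ≤ n)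
    (v : (realField R)ˣ) (hv : (v : realField R) = n) :
    (QuotientGroup.mk v : cmNormResidueGroup R) = splitDiscriminantClassCM R 2 ↔
      ∀ ℓ : ℕ, ℓ.Prime → (ℓ % 60 = 7 ∨ ℓ % 60 = 11 ∨ ℓ % 60 = 43 ∨ ℓ % 60 = 59) → Even (n.factorization ℓ) := by
  refine (natCast_eq_split_iff_even (fun ℓ ↦ ¬ (ℓ % 60 = 7 ∨ ℓ % 60 = 11 ∨ ℓ % 60 = 43 ∨ ℓ % 60 = 59)) 1 ?_ (fun h ↦ absurd h Nat.not_prime_one) ?_ n hn v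
    hv).trans (forall_congr' fun ℓ ↦ forall_congr' fun _ ↦ by simp only [not_not])
  · intro ℓ hℓ hs u hu
    by_contra hne
    exact hs ((sqrtNeg1Sqrt15_mk_prime_ne_splitDiscriminantClassCM_iff_mod hR hℓ u hu even_two).1 hne)
  · intro ℓ hℓ hs _ w hw u hu
    exact sqrtNeg1Sqrt15_mk_natCast_mul_ne_splitDiscriminantClassCM hR hℓ (not_not.1 hs) hw u
      (by rw [hu, map_mul, map_natCast, map_intCast]) even_two

/-- **ROW STRUCTURE of the `ℚ(i,√15)` table**: `[n₁] = [n₂] ⟺` the primes `ℓ` with `ℓ % 60 = 7 ∨ ℓ % 60 = 11 ∨ ℓ % 60 = 43 ∨ ℓ % 60 = 59` occur in `n₁`, `n₂` with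
exponents of the same parity. [cite: Deligne1982HodgeCycles, §4 (1) and Cor. 4.2] [cite: Landherr1936HermitianForms] -/
theorem sqrtNeg1Sqrt15_natCast_mk_eq_mk_iff (hR : R = X ^ 2 + C 32 * X + C 196) {n₁ n₂ : ℕ} (hn₁ : 1 ≤ n₁) (hn₂ : 1 ≤ n₂)
    (u v : (realField R)ˣ) (hu : (u : realField R) = n₁) (hv : (v : realField R) = n₂) :
    (QuotientGroup.mk u : cmNormResidueGroup R) = QuotientGroup.mk v ↔
      ∀ ℓ : ℕ, ℓ.Prime → (ℓ % 60 = 7 ∨ ℓ % 60 = 11 ∨ ℓ % 60 = 43 ∨ ℓ % 60 = 59) → (Even (n₁.factorization ℓ) ↔ Even (n₂.factorization ℓ)) := by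
  refine (natCast_mk_eq_mk_iff_even (fun ℓ ↦ ¬ (ℓ % 60 = 7 ∨ ℓ % 60 = 11 ∨ ℓ % 60 = 43 ∨ ℓ % 60 = 59)) 1 ?_ (fun h ↦ absurd h Nat.not_prime_one) ?_ hn₁ hn₂
    u v hu hv).trans (forall_congr' fun ℓ ↦ forall_congr' fun _ ↦ by simp only [not_not])
  · intro ℓ hℓ hs u hu
    by_contra hne
    exact hs ((sqrtNeg1Sqrt15_mk_prime_ne_splitDiscriminantClassCM_iff_mod hR hℓ u hu even_two).1 hne)
  · intro ℓ hℓ hs _ w hw u hu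
    exact sqrtNeg1Sqrt15_mk_natCast_mul_ne_splitDiscriminantClassCM hR hℓ (not_not.1 hs) hw u
      (by rw [hu, map_mul, map_natCast, map_intCast]) even_two

end IsqrtNeg1Sqrt15

/-! ### §82 `E = ℚ(√-5,√3)` (`R = S² + 40S + 100`, `F = ℚ(√3)`): non-split primes `ℓ % 60 = 11 ∨ ℓ % 60 = 13 ∨ ℓ % 60 = 37 ∨ ℓ % 60 = 59` -/
section IsqrtNeg5Sqrt3
/-- **Cofactor obstruction for `ℚ(√-5,√3)`**: for every non-split prime `ℓ` (`ℓ % 60 = 11 ∨ ℓ % 60 = 13 ∨ ℓ % 60 = 37 ∨ ℓ % 60 = 59`) and every `w ∈ ℤ` with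
`ℓ ∤ w`: `[ℓ·w] ≠ [(-1)^k]` (`k` even) — the inert degree-one place over `ℓ` of part 12 has `ord_v(ℓw) = ord_v ℓ` odd.
[cite: Deligne1982HodgeCycles, §4 (1) and Cor. 4.2] [cite: Omeara1963, §63B Example 63:12 and §71D Thm. 71:18] -/
theorem sqrtNeg5Sqrt3_mk_natCast_mul_ne_splitDiscriminantClassCM (hR : R = X ^ 2 + C 40 * X + C 100) {ℓ : ℕ} (hℓ : ℓ.Prime)
    (hS : ℓ % 60 = 11 ∨ ℓ % 60 = 13 ∨ ℓ % 60 = 37 ∨ ℓ % 60 = 59) {w : ℤ} (hw : ¬ (ℓ : ℤ) ∣ w) (qℓ : (realField R)ˣ)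
    (hqℓ : (qℓ : realField R) = (ℓ : realField R) * (w : realField R)) {k : ℕ} (hk : Even k) :
    (QuotientGroup.mk qℓ : cmNormResidueGroup R) ≠ splitDiscriminantClassCM R k := by
  have hnsq : ¬ IsSquare (((3 : ℤ) : ℤ) : ZMod 5) := by decide
  have hp0 : ℓ ≠ 5 := by omega
  haveI := Fact.mk hℓ
  have hroots := roots_real_neg_of_quadratic hR (by norm_num) (by norm_num) (by norm_num)
  have hrel := root_rel_quadratic hR
  push_cast at hrel
  have hℓ0 : (ℓ : realField R) ≠ 0 := by exact_mod_cast hℓ.ne_zero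
  have hne := (sqrtNeg5Sqrt3_mk_prime_ne_splitDiscriminantClassCM_iff_mod hR hℓ (Units.mk0 _ hℓ0) (Units.val_mk0 _)
    even_two).2 hS
  obtain ⟨s, -, hs⟩ := sqrtNeg5Sqrt3_ratPrimeRule_exists_sq_eq_3 hR
  have hs' : s ^ 2 = ((3 : ℤ) : 𝓞 (realField R)) := by rw [hs]; norm_num
  have hb := radicand_places_of_inert (finrank_realField_quadratic hR) hs' Nat.prime_five hnsq hℓ hp0
  have hfac : AdjoinRoot.root (realPolyQ R) = ((-1 : realField R) + (-1/10 : realField R) * AdjoinRoot.root (realPolyQ R)) ^ 2 * (((-(5 : ℕ) : ℤ) : 𝓞 (realField R)) : realField R) := by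
    rw [show (((-(5 : ℕ) : ℤ) : 𝓞 (realField R)) : realField R) = ((-(5 : ℕ) : ℤ) : realField R) from
      map_intCast (algebraMap (𝓞 (realField R)) (realField R)) _]
    push_cast
    linear_combination (1/20 : realField R) * hrel
  exact mk_natCast_mul_ne_splitDiscriminantClassCM_of_ne hroots hfac (sqrtNeg5Sqrt3_ratPrimeRule_dyadic_unique hR) hℓ hb
    (Units.mk0 _ hℓ0) (Units.val_mk0 _) even_two hne hw qℓ hqℓ hk

/-- **THE INTEGER ROWS of the `ℚ(√-5,√3)` table**: for `n ≥ 1`, **`[n] = [1] ⟺` every prime `ℓ` with `ℓ % 60 = 11 ∨ ℓ % 60 = 13 ∨ ℓ % 60 = 37 ∨ ℓ % 60 = 59` divides `n`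
to an EVEN power** (part IX-M's induction; no exceptional prime). [cite: Deligne1982HodgeCycles, §4 (1) and Cor. 4.2]
[cite: Landherr1936HermitianForms] -/
theorem sqrtNeg5Sqrt3_natCast_eq_splitDiscriminantClassCM_iff (hR : R = X ^ 2 + C 40 * X + C 100) (n : ℕ) (hn : 1 ≤ n)
    (v : (realField R)ˣ) (hv : (v : realField R) = n) :
    (QuotientGroup.mk v : cmNormResidueGroup R) = splitDiscriminantClassCM R 2 ↔
      ∀ ℓ : ℕ, ℓ.Prime → (ℓ % 60 = 11 ∨ ℓ % 60 = 13 ∨ ℓ % 60 = 37 ∨ ℓ % 60 = 59) → Even (n.factorization ℓ) := by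
  refine (natCast_eq_split_iff_even (fun ℓ ↦ ¬ (ℓ % 60 = 11 ∨ ℓ % 60 = 13 ∨ ℓ % 60 = 37 ∨ ℓ % 60 = 59)) 1 ?_ (fun h ↦ absurd h Nat.not_prime_one) ?_ n hn v
    hv).trans (forall_congr' fun ℓ ↦ forall_congr' fun _ ↦ by simp only [not_not])
  · intro ℓ hℓ hs u hu
    by_contra hne
    exact hs ((sqrtNeg5Sqrt3_mk_prime_ne_splitDiscriminantClassCM_iff_mod hR hℓ u hu even_two).1 hne)
  · intro ℓ hℓ hs _ w hw u hu
    exact sqrtNeg5Sqrt3_mk_natCast_mul_ne_splitDiscriminantClassCM hR hℓ (not_not.1 hs) hw u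
      (by rw [hu, map_mul, map_natCast, map_intCast]) even_two

/-- **ROW STRUCTURE of the `ℚ(√-5,√3)` table**: `[n₁] = [n₂] ⟺` the primes `ℓ` with `ℓ % 60 = 11 ∨ ℓ % 60 = 13 ∨ ℓ % 60 = 37 ∨ ℓ % 60 = 59` occur in `n₁`, `n₂` with
exponents of the same parity. [cite: Deligne1982HodgeCycles, §4 (1) and Cor. 4.2] [cite: Landherr1936HermitianForms] -/
theorem sqrtNeg5Sqrt3_natCast_mk_eq_mk_iff (hR : R = X ^ 2 + C 40 * X + C 100) {n₁ n₂ : ℕ} (hn₁ : 1 ≤ n₁) (hn₂ : 1 ≤ n₂)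
    (u v : (realField R)ˣ) (hu : (u : realField R) = n₁) (hv : (v : realField R) = n₂) :
    (QuotientGroup.mk u : cmNormResidueGroup R) = QuotientGroup.mk v ↔
      ∀ ℓ : ℕ, ℓ.Prime → (ℓ % 60 = 11 ∨ ℓ % 60 = 13 ∨ ℓ % 60 = 37 ∨ ℓ % 60 = 59) → (Even (n₁.factorization ℓ) ↔ Even (n₂.factorization ℓ)) := by
  refine (natCast_mk_eq_mk_iff_even (fun ℓ ↦ ¬ (ℓ % 60 = 11 ∨ ℓ % 60 = 13 ∨ ℓ % 60 = 37 ∨ ℓ % 60 = 59)) 1 ?_ (fun h ↦ absurd h Nat.not_prime_one) ?_ hn₁ hn₂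
    u v hu hv).trans (forall_congr' fun ℓ ↦ forall_congr' fun _ ↦ by simp only [not_not])
  · intro ℓ hℓ hs u hu
    by_contra hne
    exact hs ((sqrtNeg5Sqrt3_mk_prime_ne_splitDiscriminantClassCM_iff_mod hR hℓ u hu even_two).1 hne)
  · intro ℓ hℓ hs _ w hw u hu
    exact sqrtNeg5Sqrt3_mk_natCast_mul_ne_splitDiscriminantClassCM hR hℓ (not_not.1 hs) hw u
      (by rw [hu, map_mul, map_natCast, map_intCast]) even_two

end IsqrtNeg5Sqrt3

/-! ### §83 `E = ℚ(√-3,√-5)` (`R = S² + 16S + 4`, `F = ℚ(√15)`): non-split primes `ℓ % 60 = 11 ∨ ℓ % 60 = 17 ∨ ℓ % 60 = 53 ∨ ℓ % 60 = 59` -/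
section IsqrtNeg3SqrtNeg5
/-- **Cofactor obstruction for `ℚ(√-3,√-5)`**: for every non-split prime `ℓ` (`ℓ % 60 = 11 ∨ ℓ % 60 = 17 ∨ ℓ % 60 = 53 ∨ ℓ % 60 = 59`) and every `w ∈ ℤ` with
`ℓ ∤ w`: `[ℓ·w] ≠ [(-1)^k]` (`k` even) — the inert degree-one place over `ℓ` of part 12 has `ord_v(ℓw) = ord_v ℓ` odd.
[cite: Deligne1982HodgeCycles, §4 (1) and Cor. 4.2] [cite: Omeara1963, §63B Example 63:12 and §71D Thm. 71:18] -/
theorem sqrtNeg3SqrtNeg5_mk_natCast_mul_ne_splitDiscriminantClassCM (hR : R = X ^ 2 + C 16 * X + C 4) {ℓ : ℕ} (hℓ : ℓ.Prime)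
    (hS : ℓ % 60 = 11 ∨ ℓ % 60 = 17 ∨ ℓ % 60 = 53 ∨ ℓ % 60 = 59) {w : ℤ} (hw : ¬ (ℓ : ℤ) ∣ w) (qℓ : (realField R)ˣ)
    (hqℓ : (qℓ : realField R) = (ℓ : realField R) * (w : realField R)) {k : ℕ} (hk : Even k) :
    (QuotientGroup.mk qℓ : cmNormResidueGroup R) ≠ splitDiscriminantClassCM R k := by
  have hp0 : ℓ ≠ 3 := by omega
  haveI := Fact.mk hℓ
  have hroots := roots_real_neg_of_quadratic hR (by norm_num) (by norm_num) (by norm_num)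
  have hrel := root_rel_quadratic hR
  push_cast at hrel
  have hℓ0 : (ℓ : realField R) ≠ 0 := by exact_mod_cast hℓ.ne_zero
  have hne := (sqrtNeg3SqrtNeg5_mk_prime_ne_splitDiscriminantClassCM_iff_mod hR hℓ (Units.mk0 _ hℓ0) (Units.val_mk0 _)
    even_two).2 hS
  obtain ⟨s, -, hs⟩ := sqrtNeg3SqrtNeg5_ratPrimeRule_exists_sq_eq_15 hR
  have hb := radicand_places_of_ramified (finrank_realField_quadratic hR) Nat.prime_three (π := s) (w := 5) (a := 2) (b := -1)
    (by rw [hs]; norm_num) (by norm_num) hℓ hp0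
  have hfac : AdjoinRoot.root (realPolyQ R) = ((-1/3 : realField R) + (-1/6 : realField R) * AdjoinRoot.root (realPolyQ R)) ^ 2 * (((-(3 : ℕ) : ℤ) : 𝓞 (realField R)) : realField R) := by
    rw [show (((-(3 : ℕ) : ℤ) : 𝓞 (realField R)) : realField R) = ((-(3 : ℕ) : ℤ) : realField R) from
      map_intCast (algebraMap (𝓞 (realField R)) (realField R)) _]
    push_cast
    linear_combination (1/12 : realField R) * hrel
  exact mk_natCast_mul_ne_splitDiscriminantClassCM_of_ne hroots hfac (sqrtNeg3SqrtNeg5_ratPrimeRule_dyadic_unique hR) hℓ hb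
    (Units.mk0 _ hℓ0) (Units.val_mk0 _) even_two hne hw qℓ hqℓ hk

/-- **THE INTEGER ROWS of the `ℚ(√-3,√-5)` table**: for `n ≥ 1`, **`[n] = [1] ⟺` every prime `ℓ` with `ℓ % 60 = 11 ∨ ℓ % 60 = 17 ∨ ℓ % 60 = 53 ∨ ℓ % 60 = 59` divides `n`
to an EVEN power** (part IX-M's induction; no exceptional prime). [cite: Deligne1982HodgeCycles, §4 (1) and Cor. 4.2]
[cite: Landherr1936HermitianForms] -/
theorem sqrtNeg3SqrtNeg5_natCast_eq_splitDiscriminantClassCM_iff (hR : R = X ^ 2 + C 16 * X + C 4) (n : ℕ) (hn : 1 ≤ n)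
    (v : (realField R)ˣ) (hv : (v : realField R) = n) :
    (QuotientGroup.mk v : cmNormResidueGroup R) = splitDiscriminantClassCM R 2 ↔
      ∀ ℓ : ℕ, ℓ.Prime → (ℓ % 60 = 11 ∨ ℓ % 60 = 17 ∨ ℓ % 60 = 53 ∨ ℓ % 60 = 59) → Even (n.factorization ℓ) := by
  refine (natCast_eq_split_iff_even (fun ℓ ↦ ¬ (ℓ % 60 = 11 ∨ ℓ % 60 = 17 ∨ ℓ % 60 = 53 ∨ ℓ % 60 = 59)) 1 ?_ (fun h ↦ absurd h Nat.not_prime_one) ?_ n hn v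
    hv).trans (forall_congr' fun ℓ ↦ forall_congr' fun _ ↦ by simp only [not_not])
  · intro ℓ hℓ hs u hu
    by_contra hne
    exact hs ((sqrtNeg3SqrtNeg5_mk_prime_ne_splitDiscriminantClassCM_iff_mod hR hℓ u hu even_two).1 hne)
  · intro ℓ hℓ hs _ w hw u hu
    exact sqrtNeg3SqrtNeg5_mk_natCast_mul_ne_splitDiscriminantClassCM hR hℓ (not_not.1 hs) hw u
      (by rw [hu, map_mul, map_natCast, map_intCast]) even_two

/-- **ROW STRUCTURE of the `ℚ(√-3,√-5)` table**: `[n₁] = [n₂] ⟺` the primes `ℓ` with `ℓ % 60 = 11 ∨ ℓ % 60 = 17 ∨ ℓ % 60 = 53 ∨ ℓ % 60 = 59` occur in `n₁`, `n₂` with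
exponents of the same parity. [cite: Deligne1982HodgeCycles, §4 (1) and Cor. 4.2] [cite: Landherr1936HermitianForms] -/
theorem sqrtNeg3SqrtNeg5_natCast_mk_eq_mk_iff (hR : R = X ^ 2 + C 16 * X + C 4) {n₁ n₂ : ℕ} (hn₁ : 1 ≤ n₁) (hn₂ : 1 ≤ n₂)
    (u v : (realField R)ˣ) (hu : (u : realField R) = n₁) (hv : (v : realField R) = n₂) :
    (QuotientGroup.mk u : cmNormResidueGroup R) = QuotientGroup.mk v ↔
      ∀ ℓ : ℕ, ℓ.Prime → (ℓ % 60 = 11 ∨ ℓ % 60 = 17 ∨ ℓ % 60 = 53 ∨ ℓ % 60 = 59) → (Even (n₁.factorization ℓ) ↔ Even (n₂.factorization ℓ)) := by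
  refine (natCast_mk_eq_mk_iff_even (fun ℓ ↦ ¬ (ℓ % 60 = 11 ∨ ℓ % 60 = 17 ∨ ℓ % 60 = 53 ∨ ℓ % 60 = 59)) 1 ?_ (fun h ↦ absurd h Nat.not_prime_one) ?_ hn₁ hn₂
    u v hu hv).trans (forall_congr' fun ℓ ↦ forall_congr' fun _ ↦ by simp only [not_not])
  · intro ℓ hℓ hs u hu
    by_contra hne
    exact hs ((sqrtNeg3SqrtNeg5_mk_prime_ne_splitDiscriminantClassCM_iff_mod hR hℓ u hu even_two).1 hne)
  · intro ℓ hℓ hs _ w hw u hu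
    exact sqrtNeg3SqrtNeg5_mk_natCast_mul_ne_splitDiscriminantClassCM hR hℓ (not_not.1 hs) hw u
      (by rw [hu, map_mul, map_natCast, map_intCast]) even_two

end IsqrtNeg3SqrtNeg5

end Summit.HodgeConjecture.HodgeConjecture.Ring2.WeilCoverageCM

end
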